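import Summits.HodgeConjecture.HodgeConjecture.Theorems.F0P3cStCharTSQuadraticFormNegHalf   -- ★ p852106 (this seat) (D3b): §1 `…_of_ne_zero`, §4 `…_of_hasStrictFDerivAt`, §5 `coe_inv_residueFieldCard_pow_rpow_neg_lt`; brings ★ template p852049, ★ FILE A p852078
import Mathlib.Analysis.Calculus.FDeriv.Pow
import HarnessLib

/-!
# F0 · P3c · ROAD «HC-D», brick (D3c) «MODEL INTEGRAL, PLANE CUSP»: `|c₃ a³ + c₂ b²|^{−s} ∈ L¹_loc(F²)` (`c₃ c₂ ≠ 0`, `6 ≠ 0` in `F`, `6s < 5`); in particular the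
# discriminant `δ(a,b) = −4a³ − 27·d·b²` of `X³ + aX + b` (twisted by `d ≠ 0`) to the power `−1/2`

Cell `pub/hodgecm-mathlib`, crux H413 = `stmt-HodgeConjecture-24833` (lane `--supports … --as helper`), route HCCMUnconditional; ROAD «HC-D» (LEAD F0P3a-plan T14-10;
holder ∕ dealer F0P2-p01 (g23), CENSUS-HCD v1 764fd71ae1289285 §2 row D3 (c); DEAL 2026-09-02T16:16:05Z), seat F0P3b-p01 (g18).  THEOREMS ONLY (no definition ∕
instance ∕ notation ∕ named fact ∕ `sorry`); ★-only imports.  `Theorems/`-level (not the dealt `Literature/NumberTheory/Automorphic/LocalFieldCuspDiscriminantNegHalf.lean`)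
because its inputs ★ FILE A ∕ ★ D2 ∕ (D3b) are `Summits` modules.  Consumer: D5(i) (F0P3-p04: `|δ ∘ χ|^{−1/2}` near regular points via ★ FILE A) and D5(iv).
HONEST LABEL: count-neutral; HC_CM is proved only modulo the printed citations (hLiu418 = `stmt-HodgeConjecture-24832`, h413 = `stmt-HodgeConjecture-24833`) until rung 0 closes.

## Statement (HEAD `forall_exists_nhds_setLIntegral_cubeSquare_rpow_neg_lt_top`)

`F` a non-archimedean local field (Borel, `μ` additive Haar), `c₃ c₂ : F` non-zero, `(6 : F) ≠ 0` (residue characteristic `≠ 2, 3` is NOT needed — only `char F ∤ 6`),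
`s` real with `6s < 5`.  Then every `y : Fin 2 → F` has a neighbourhood `U` with
  `∫⁻ x in U, (↑|c₃ (x 0)³ + c₂ (x 1)²|)^{−s} ∂(Measure.pi μ) < ∞`.
Corollaries: `…_cuspDiscriminant_…` for `δ x = −4 (x 0)³ − 27 d (x 1)²`, `d ≠ 0`, and its `s = 1/2` reading (the docking token of D5(i)).  The exponent bound is sharp:
`|δ|^{−s}` is homogeneous of weight `q^{6s}` for the dilation `(a,b) ↦ (ϖ²a, ϖ³b)` of modulus `q^{−5}`, so the integral over a ball at `0` is a geometric series of ratio
`q^{6s−5}` [HarishChandra1970, Part VII §1 Thm. 15 with §7: for `U(3)`∕`GL(3)` the nilpotent-cone contribution `|η|^{−1/2}` sits exactly at `6s = 3 < 5`].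

## Proof

★ template `exists_nhds_setLIntegral_lt_top_of_dilation` (weights `(2,3)`, `κ = q^{6s} < q⁵`) reduces to points `y ≠ 0`; there either `δ y ≠ 0` (★ (D3b) §1: `|δ|` locally
constant) or `δ y = 0` and the derivative `v ↦ 3c₃ y₀² v₀ + 2c₂ y₁ v₁` (Mathlib `HasStrictFDerivAt.pow ∕ const_mul ∕ add` on the coordinate projections, valuation norm of
ruling R1 via `letI`) is onto `F` (`y₀ ≠ 0 ⇒ 3c₃y₀² ≠ 0`; `y₀ = 0 ⇒ y₁ ≠ 0 ⇒ 2c₂y₁ ≠ 0`; `2, 3 ≠ 0` from `6 ≠ 0`), so ★ (D3b) §4 (= ★ FILE A + ★ (D3a), `s < 1`) applies.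

## References
* [HarishChandra1970] Harish-Chandra, *Harmonic analysis on reductive p-adic groups*, LNM 162 (1970), Part VII §1 Thm. 15, §7.
* [WeilBNT1967] A. Weil, *Basic Number Theory* (1967), Ch. I §2, Ch. II §1.
* [Schikhof1984] W. H. Schikhof, *Ultrametric Calculus* (1984), §27.
-/

set_option autoImplicit false
-- the mandated namespace has the single-problem summit's repeated segment (`HodgeConjecture.HodgeConjecture`)
set_option linter.dupNamespace false

noncomputable section

open MeasureTheory MeasureTheory.Measure ValuativeRel Filter Topology Set Matrix
open scoped NNReal ENNReal Pointwise
open Literature.NumberTheory.GaloisRepresentations.IsNonarchimedeanLocalField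
open Literature.NumberTheory.Automorphic Literature.NumberTheory.Automorphic.LocalFieldHaar
open Summit.HodgeConjecture.HodgeConjecture.Cruxes.H413.F0P3cStCharTSQuadraticFormNegHalf

namespace Summit.HodgeConjecture.HodgeConjecture.Cruxes.H413.F0P3cStCharTSCuspDiscriminantNegHalf

/-! ## §1 The strict derivative of `(a,b) ↦ c₃ a³ + c₂ b²` (valuation norm via `letI`, ruling R1) -/

section Deriv

variable {F : Type*} [Field F] [ValuativeRel F] [TopologicalSpace F] [IsNonarchimedeanLocalField F]

/-- **`x ↦ c₃ (x 0)³ + c₂ (x 1)²` is strictly differentiable at `y` with derivative `v ↦ 3c₃ (y 0)² v 0 + 2c₂ (y 1) v 1`** (existential in the continuous linear map; Mathlib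
`hasStrictFDerivAt_apply`, `HasStrictFDerivAt.pow`, `.const_mul`, `.add`). [cite: Schikhof1984, §27] -/
theorem exists_hasStrictFDerivAt_cubeSquare (c₃ c₂ : F) (y : Fin 2 → F) :
    letI := nontriviallyNormedField F
    ∃ L : (Fin 2 → F) →L[F] F, (∀ v, L v = 3 * c₃ * y 0 ^ 2 * v 0 + 2 * c₂ * y 1 * v 1) ∧
      HasStrictFDerivAt (fun x : Fin 2 → F => c₃ * x 0 ^ 3 + c₂ * x 1 ^ 2) L y := by
  letI := nontriviallyNormedField F
  have h0 := hasStrictFDerivAt_apply (𝕜 := F) (F' := fun _ : Fin 2 => F) (0 : Fin 2) y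
  have h1 := hasStrictFDerivAt_apply (𝕜 := F) (F' := fun _ : Fin 2 => F) (1 : Fin 2) y
  have h := ((h0.pow 3).const_mul c₃).add ((h1.pow 2).const_mul c₂)
  refine ⟨_, fun v => ?_, h⟩
  simp only [_root_.add_apply, FunLike.coe_smul, Pi.smul_apply, ContinuousLinearMap.proj_apply, smul_eq_mul,
    nsmul_eq_mul, Nat.cast_ofNat]
  norm_num
  ring

end Deriv

/-! ## §2 The HEAD and its cusp-discriminant reading -/

section Measure

variable {F : Type*} [Field F] [ValuativeRel F] [TopologicalSpace F] [IsNonarchimedeanLocalField F]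
  [MeasurableSpace F] [BorelSpace F] (μ : Measure F) [μ.IsAddHaarMeasure]

/-- **(D3c) HEAD — `|c₃ a³ + c₂ b²|^{−s} ∈ L¹_loc(F²)`** for `c₃ ≠ 0`, `c₂ ≠ 0`, `(6 : F) ≠ 0`, `6s < 5`: every `y : Fin 2 → F` has a neighbourhood `U` with
`∫⁻ x in U, (↑(normAbs F (c₃ * x 0 ^ 3 + c₂ * x 1 ^ 2)))^{−s} ∂(Measure.pi μ) < ∞`. [cite: HarishChandra1970, Part VII §1 Thm. 15] [cite: WeilBNT1967, Ch. II §1] -/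
theorem forall_exists_nhds_setLIntegral_cubeSquare_rpow_neg_lt_top {c₃ c₂ : F} (hc₃ : c₃ ≠ 0) (hc₂ : c₂ ≠ 0) (h6 : (6 : F) ≠ 0) {s : ℝ} (hs : 6 * s < 5) :
    ∀ y : Fin 2 → F, ∃ U ∈ 𝓝 y,
      ∫⁻ x in U, ((normAbs F (c₃ * x 0 ^ 3 + c₂ * x 1 ^ 2) : ℝ≥0∞)) ^ (-s) ∂(Measure.pi fun _ : Fin 2 => μ) < ∞ := by
  haveI := secondCountableTopology_localField F
  have h2 : (2 : F) ≠ 0 := fun h => h6 (by rw [show (6 : F) = 2 * 3 by norm_num, h, zero_mul])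
  have h3 : (3 : F) ≠ 0 := fun h => h6 (by rw [show (6 : F) = 2 * 3 by norm_num, h, mul_zero])
  have hs1 : s < 1 := by linarith
  obtain ⟨ϖ, -, hϖ⟩ := exists_normAbs_eq_inv (F := F)
  have hδc : Continuous fun x : Fin 2 → F => c₃ * x 0 ^ 3 + c₂ * x 1 ^ 2 := by fun_prop
  have hgm : Measurable fun x : Fin 2 → F => ((normAbs F (c₃ * x 0 ^ 3 + c₂ * x 1 ^ 2) : ℝ≥0∞)) ^ (-s) :=
    ((measurable_normAbs.comp hδc.measurable).coe_nnreal_ennreal).pow_const _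
  refine exists_nhds_setLIntegral_lt_top_of_dilation μ hϖ (w := ![2, 3]) (by decide) two_ne_zero
    (fun x => ((normAbs F (c₃ * x 0 ^ 3 + c₂ * x 1 ^ 2) : ℝ≥0∞)) ^ (-s)) hgm (κ := ((normAbs F ϖ ^ 6 : ℝ≥0) : ℝ≥0∞) ^ (-s)) ?_ ?_ ?_
  · -- quasi-homogeneity of weight 6 for the weights (2,3)
    intro x
    simp only [Matrix.cons_val_zero, Matrix.cons_val_one]
    have hhom : c₃ * (ϖ ^ 2 * x 0) ^ 3 + c₂ * (ϖ ^ 3 * x 1) ^ 2 = ϖ ^ 6 * (c₃ * x 0 ^ 3 + c₂ * x 1 ^ 2) := by ring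
    rw [hhom, map_mul, map_pow, ENNReal.coe_mul, ENNReal.mul_rpow_of_ne_top ENNReal.coe_ne_top ENNReal.coe_ne_top]
  · -- `κ = q^{6s} < q^{2+3}`
    rw [hϖ]
    exact coe_inv_residueFieldCard_pow_rpow_neg_lt (by norm_num [Fin.sum_univ_two]; linarith)
  · intro y hy
    by_cases hδy : c₃ * y 0 ^ 3 + c₂ * y 1 ^ 2 = 0
    · letI := nontriviallyNormedField F
      obtain ⟨L, hL, hδ⟩ := exists_hasStrictFDerivAt_cubeSquare c₃ c₂ y
      have hLsurj : Function.Surjective L := by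
        -- a basis vector on which `L` does not vanish
        have hex : ∃ e : Fin 2 → F, L e ≠ 0 := by
          by_cases hy0 : y 0 = 0
          · have hy1 : y 1 ≠ 0 := by
              intro hy1; apply hy; funext i; fin_cases i
              · exact hy0
              · exact hy1
            refine ⟨Pi.single 1 1, ?_⟩
            rw [hL, Pi.single_eq_same, Pi.single_eq_of_ne (show (0 : Fin 2) ≠ 1 by decide), mul_zero, zero_add, mul_one]
            exact mul_ne_zero (mul_ne_zero h2 hc₂) hy1
          · refine ⟨Pi.single 0 1, ?_⟩
            rw [hL, Pi.single_eq_same, Pi.single_eq_of_ne (show (1 : Fin 2) ≠ 0 by decide), mul_zero, add_zero, mul_one]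
            exact mul_ne_zero (mul_ne_zero h3 hc₃) (pow_ne_zero 2 hy0)
        obtain ⟨e, he⟩ := hex
        exact fun a => ⟨(a / L e) • e, by rw [map_smul, smul_eq_mul, div_mul_cancel₀ a he]⟩
      exact exists_nhds_setLIntegral_rpow_neg_lt_top_of_hasStrictFDerivAt μ hδ hLsurj hδy hs1
    · exact exists_nhds_setLIntegral_rpow_neg_lt_top_of_ne_zero μ hδc s hδy

/-- **(D3c) for the cusp discriminant `δ(a,b) = −4a³ − 27·d·b²`** (`d ≠ 0`, `(6 : F) ≠ 0`, `6s < 5`): every `y : Fin 2 → F` has a neighbourhood `U` with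
`∫⁻ x in U, (↑(normAbs F (-4 * x 0 ^ 3 - 27 * d * x 1 ^ 2)))^{−s} ∂(Measure.pi μ) < ∞`. [cite: HarishChandra1970, Part VII §1 Thm. 15] -/
theorem forall_exists_nhds_setLIntegral_cuspDiscriminant_rpow_neg_lt_top {d : F} (hd : d ≠ 0) (h6 : (6 : F) ≠ 0) {s : ℝ} (hs : 6 * s < 5) :
    ∀ y : Fin 2 → F, ∃ U ∈ 𝓝 y,
      ∫⁻ x in U, ((normAbs F (-4 * x 0 ^ 3 - 27 * d * x 1 ^ 2) : ℝ≥0∞)) ^ (-s) ∂(Measure.pi fun _ : Fin 2 => μ) < ∞ := by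
  have h2 : (2 : F) ≠ 0 := fun h => h6 (by rw [show (6 : F) = 2 * 3 by norm_num, h, zero_mul])
  have h3 : (3 : F) ≠ 0 := fun h => h6 (by rw [show (6 : F) = 2 * 3 by norm_num, h, mul_zero])
  have hc₃ : (-4 : F) ≠ 0 := by
    rw [show (-4 : F) = -(2 * 2) by norm_num]; exact neg_ne_zero.2 (mul_ne_zero h2 h2)
  have hc₂ : (-(27 * d) : F) ≠ 0 := by
    rw [show (27 : F) = 3 * 3 * 3 by norm_num]; exact neg_ne_zero.2 (mul_ne_zero (mul_ne_zero (mul_ne_zero h3 h3) h3) hd)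
  have h := forall_exists_nhds_setLIntegral_cubeSquare_rpow_neg_lt_top μ hc₃ hc₂ h6 hs
  intro y
  obtain ⟨U, hU, hfin⟩ := h y
  refine ⟨U, hU, ?_⟩
  have hint : ∀ x : Fin 2 → F, -4 * x 0 ^ 3 - 27 * d * x 1 ^ 2 = -4 * x 0 ^ 3 + -(27 * d) * x 1 ^ 2 := fun x => by ring
  simp only [hint]
  exact hfin

/-- **(D3c) at the road's exponent `s = 1/2`** (`6·½ = 3 < 5`): the docking token of D5(i). [cite: HarishChandra1970, Part VII §1 Thm. 15] -/
theorem forall_exists_nhds_setLIntegral_cuspDiscriminant_neg_half_lt_top {d : F} (hd : d ≠ 0) (h6 : (6 : F) ≠ 0) :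
    ∀ y : Fin 2 → F, ∃ U ∈ 𝓝 y,
      ∫⁻ x in U, ((normAbs F (-4 * x 0 ^ 3 - 27 * d * x 1 ^ 2) : ℝ≥0∞)) ^ (-(1 / 2 : ℝ)) ∂(Measure.pi fun _ : Fin 2 => μ) < ∞ :=
  forall_exists_nhds_setLIntegral_cuspDiscriminant_rpow_neg_lt_top μ hd h6 (by norm_num)

end Measure

end Summit.HodgeConjecture.HodgeConjecture.Cruxes.H413.F0P3cStCharTSCuspDiscriminantNegHalf

end
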